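import Summits.ResolutionOfSingularities.ResolutionOfSingularities.Theorems.FrobeniusClosingSteerArithTransportWords
import Summits.ResolutionOfSingularities.ResolutionOfSingularities.Theorems.FrobeniusClosingSteerArithLeafWords
import HarnessLib

/-!
# Crux `Steer` (stmt-ResolutionOfSingularities-16345), β-leaf debt K-β0(a) — the WORD `TernaryConePersistsTwoN`
  (res-D-pv-053 g9 on res-L0-w41-plan-1 RULING 303 (b); the β-leaf of record `Sketch-idea-1-v18-hatleaf.v184-J4K7SHCPTKFSXPCFY.lean`
  06c4d7bb9e190078 l.747, designed sorry `ternaryConePersists_holds` l.805; reader res-L0-w41-tri-1 g8)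

OURS (campaign `res-hironaka`, rung L ★L-G4, slot W4.1). Candidates, not facts; nothing here is a statement of H. Hironaka's manuscript
[Hironaka2017] (status: under review). AI-written; AI review is weaker than expert review. ONE `def … : Prop` (a SIGNATURE), 0 sorries, no proof.

THE WORD is the β-leaf's `TernaryConePersistsTwoN` VERBATIM, binder for binder, with two purely nominal changes so that it type-checks against
the TREE instead of the leaf: (1) the leaf-local predicate `BinaryConeAt R P s p d i` is replaced by `IsPointStep R P i ∧ ArithTransport.BinaryConeE2At
R s p d i` (res-L0-w41-strat-2's words file `…ArithTransportWords`, p571472, whose `BinaryConeE2At` is the body of `BinaryConeAt` minus the `IsPointStep`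
conjunct — the conjunction is DEFINITIONALLY the leaf's `BinaryConeAt`, so the leaf hunk «TCP» `ternaryConePersists_holds := …` is an `exact`);
(2) `ArithSwitchClause` / `OddCleanedPointStepAt` / `ArithBinaryResidueAt` are the `Words.`-qualified W30 copies (`…Words30SigmaLeafParS`), as in
res-L0-w41-stub-3's accepted shape `ArithTransport.arithTransport_of_words` (c21af71a100de005, RULING 303 (c)), whose «K-β0(a)-concl» hypothesis is the
conclusion line below verbatim — the unqualified names are ambiguous with the body-identical `ArithReduction.` twins once both files are imported.

WHAT IT SAYS. Under the hK4ⁿᶜ tail binders (core datum, rank one, normalised start, σ_top-steered run, no dominant tail, eventual high order, finitely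
many height-≥2 steps, infinitely many positive steps, point steps with non-isolated singularity beyond every bound, NO persistent parameter, the
arithmetic switch clause) and for an odd `d ≥ 3` which is the degree of an arithmetic binary residue beyond every bound: from some index on, EVERY
odd-cleaned point step carries a BINARY cone of degree `d` with `e = 2` (the cleaned tangent form is `Ψ(m₁, m₂)` in an r.s.o.p.-part pair modulo
`𝔪^(d+1)`, `Ψ̄` not a scalar multiple of a `d`-th power of a linear form).

WHY IT SHOULD HOLD (the leaf docstring, res-L0-w41-tri-1 TRIAGE v6.20 §169d): (i) at a switch-adjacent A-stage `e = 2` is the near-point condition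
(R2)/(R4) (`BinaryResidue.binary_of_restrict_eq_of_cone_fourVar`, p531760; `SatelliteStep.not_excParam_iff_div_not_isUnit`, p540812); (ii) an A-stage with a
cone in `≥ 3` variables admits no satellite, its exceptional parameter persists through the free block and, by the restriction identity and induction,
for ever — contradicting the persistence binder; degree matching with the switch degree is order constancy (S1b). Why it might fail / what the proof
must also supply (this seat's reading, recorded for the reader): the case `e = 1` (`Ψ̄ = c·ℓ^d`, a pure odd power) is not covered by (i)/(ii) and is
excluded only by MONOTONICITY of the number of variables of the cleaned cone along consecutive A-stages together with ONE arithmetic (hence `e = 2`)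
stage; both (ii) and that monotonicity are run-level near-point statements, i.e. WORDS, not consequences of the one-step chart bricks (G1)–(G4) alone.
-/

-- `Summit.<S>.<S>.…` duplicates the summit name by design (single-problem summit).
set_option linter.dupNamespace false

open IsLocalRing
open Literature.AlgebraicGeometry.Resolution
open Summit.ResolutionOfSingularities.ResolutionOfSingularities.Theorems.SwitchingDichotomy.Words
open Summit.ResolutionOfSingularities.ResolutionOfSingularities.Theorems.SteerRankThinness (Concl HasProperCoarsening)
open Summit.ResolutionOfSingularities.ResolutionOfSingularities.Theorems.SwitchingDichotomy

namespace Summit.ResolutionOfSingularities.ResolutionOfSingularities.Theorems.SwitchingDichotomy.ArithTransport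

/-- **K-β0(a) · `TernaryConePersistsTwoN`** (β-leaf 06c4d7bb9e190078 l.747 VERBATIM; `BinaryConeAt` ↦ `IsPointStep ∧ BinaryConeE2At`, W30 names
`Words.`-qualified): under the hK4ⁿᶜ tail hypotheses, for an odd `d ≥ 3` carrying an arithmetic binary residue beyond every bound, from some index on
every odd-cleaned point step has a binary cone of degree `d` with `e = 2`. Mechanism (res-L0-w41-tri-1 §169d): (i) near-point condition at a
switch-adjacent A-stage ⇒ `e = 2`; (ii) an `e ≥ 3` late A-stage makes the exceptional parameter persist for ever, contradicting the persistence
binder; degree matching is order constancy. OURS. (folklore) -/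
def TernaryConePersistsTwoN : Prop :=
  ∀ p : ℕ, p = 2 →
    ∀ (k K : Type) [Field k] [CharP k p] [PerfectField k] [Field K] [Algebra k K]
    (O : ValuationSubring K) (A₀ : Subalgebra k K) (h₀ : A₀.toSubring ≤ O.toSubring) (t : K),
    CoreDatum p 4 k K O A₀ h₀ t → ¬ HasProperCoarsening O →
    ∀ (R : ℕ → Subring K) (P : (i : ℕ) → Ideal (R i)) (s : ℕ → K),
      R 0 = locAtCentre A₀.toSubring O → NormalAt O (R 0) p t → IsSteeredRun O R P t p s →
      (¬ ∃ i₀ c : ℕ, 1 ≤ c ∧ IsDominantTail R P i₀ c) →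
      (∃ i₀ : ℕ, ∀ i, i₀ ≤ i → IsHighOrderAt R s p i) →
      ¬ HeightTwoStepsInfinite R P → {j | IsPosStep R P j}.Infinite →
      (∀ i₀ : ℕ, ∃ i, i₀ ≤ i ∧ IsPointStep R P i ∧
        ∀ hs : s i ^ p ∈ R i, ¬ HasIsolatedSingularity (RadicandRing (R i) p ⟨s i ^ p, hs⟩)) →
      (¬ ∃ i₀ : ℕ, ∃ x : K, x ≠ 0 ∧ x ∈ O ∧ O.valuation x < 1 ∧
        ∀ i, i₀ ≤ i → ∀ y ∈ R i, O.valuation y < 1 → ∃ j, i < j ∧ y / x ∈ R j) →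
      Words.ArithSwitchClause R P s p →
      ∀ d : ℕ, Odd d → 3 ≤ d → (∀ i₁ : ℕ, ∃ i, i₁ ≤ i ∧ Words.ArithBinaryResidueAt R P s p d i) →
        ∃ i₀ : ℕ, ∀ i, i₀ ≤ i → Words.OddCleanedPointStepAt R P s p i →
          IsPointStep R P i ∧ BinaryConeE2At R s p d i

end Summit.ResolutionOfSingularities.ResolutionOfSingularities.Theorems.SwitchingDichotomy.ArithTransport
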